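/-
COR-CM (cell pub-hodgecm2, stage 2 of the Hodge ladder) — junction B01, leaf B01-O `Universe.FaceWedgeOverlap`
(`B01/FaceInputsSplit.lean`:101), the O-AS-TYPED lane (COORDINATOR RULING «FINISH-TODAY SWARM» 2026-08-21T16:13:55Z (3);
lead NAMING RULING HOME/INBOX l.4194 (3): writer of `CorCM/B01/FaceWedgeOverlap*.lean` = pub-hodgecm2-b01-x2).
Seat prover-pub-hodgecm2-b01-x2-0 (gen 1), 2026-08-21.  Theorems only: no `def`, no cite binder, nothing asserted, no `sorry`.
FRAMING (COORDINATOR RULING 2026-08-21T11:55:35Z): HC_CM is NOT proved; B01-O is NOT proved; this file REDUCES it.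
-/
import Summits.HodgeConjecture.CorCM.B01.ThetaRealisationSocket
import HarnessLib

/-!
# B01-O as typed = (item (iii) dictionary + item (v) saturated coupling) + LEVEL DESCENT — a kernel reduction

`Universe.FaceWedgeOverlap` (`B01/FaceInputsSplit.lean`:101–111) asks, for EVERY level `Γ` and EVERY non-zero (12)-wedge
`ω₀ ∪ ω₁` of `U_Ψ`-classes, for a level `Γ'` and a NON-ZERO class in `heckeSpan Γ' Γ (ω₀ ∪ ω₁) ⊓ wedgeSpan Γ' ψ₂ ψ₃` — an
INTERSECTION inside the finite-dimensional `H²(P_{Γ'}, ℂ)` at ONE level.  The live target of the transposition lane is the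
`L²`/closure form: item (iii)'s dictionary `(HG, emb, cover, emb_cover, inner_emb)` (`Transposition.AutomorphicDictionary`,
`Transposition/Item3Automorphic.lean`:96; socket fields `B01/ThetaRealisationSocket.lean`:69–95) with item (v)'s SATURATED
COUPLING «`emb Γ (ω₀ ∪ ω₁)` lies in the CLOSED span of the (34)-wedge-functions `emb Γ'' (ω₃ ∪ ω₄)` of `U_{ψ₂}`/`U_{ψ₃}`-classes
over ALL levels» — together EXACTLY the clause `hD` of `Model.hc_cm_of_supply_of_dictionary_of_eq`
(`Transposition/Item6HoldsRec.lean`:211–224; = `Transposition.IsolationSpans` at `Θ := Uiso`, `Item5IsolationSpans.lean`:115).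
Abstractly the two are incomparable (b01-x1, HOME/INBOX l.3673 (d), l.3681): a closure over all levels is not a finite
combination at one level, and `heckeSpan`-translates are not `cover`s.

THIS FILE proves that the exact surplus of B01-O over `hD` is ONE clause, **LEVEL DESCENT**, on the SAME `(HG, emb)`: for the
level `Γ` and `v = emb Γ (ω₀ ∪ ω₁)` there is a continuous linear operator `P : HG →L[ℂ] HG` with
  (P1) `P v = v`;
  (P2) for every (34)-wedge-function `y = emb Γ'' (ω₃ ∪ ω₄)` (any level `Γ''`): `P y ∈ range (emb Γ)` (a form OF LEVEL `Γ`) and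
       `P y ∈ (wedgeSpan Γ' ψ₂ ψ₃).map (emb Γ')` for SOME level `Γ'` (a finite sum of (34)-wedges at one level).
INTENDED MODEL READING (documentation, not used by the kernel): for a classical, index-normalised Petersson model of the
dictionary (`HG = L²` of the tower with `G_U(𝔸_f)` acting unitarily; cf. hazard C1 in `Item3Automorphic.lean`:47–50, :93 for the
extension-by-zero variant) `P` can be taken to be the `K_Γ`-AVERAGING (deck-averaging) operator: (P1) = level-`Γ` forms are
`K_Γ`-invariant; (P2) = for `Γ'' ≤ Γ` with `K_{Γ''}` normal in `K_Γ` (such levels are cofinal; first pull back to one by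
`emb_cover`) the average of `emb Γ'' (ω₃ ∪ ω₄)` is `emb Γ'' ((1/n) Σ_k d_k^* ω₃ ∪ d_k^* ω₄)` over the deck transformations
`d_k : P_{Γ''} → P_{Γ''}` — morphisms of the tower, so `d_k^* U_ψ ⊆ U_ψ` (`Universe.pullC_mem_Uiso`, `B01/PeriodExpansion.lean`:52)
and the average is a SUM OF PURE (34)-WEDGES AT LEVEL `Γ''` by bilinearity —, and a deck-invariant class of the Galois covering
`P_{Γ''} → P_Γ` is pulled back from level `Γ` (transfer), so it lies in `range (emb Γ)` by `emb_cover`.  I.e. LEVEL DESCENT =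
translate-equivariance of the embedding (degree-2 analogue of `Literature/AlgebraicGeometry/ShimuraVarieties/
UnitaryBallClassLiftTranslate.lean`) + deck transformations as `U.Mor` + descent of invariants along finite Galois coverings:
known results, no new estimate, no theta input.  Finite-dimensionality is then AUTOMATIC (`range (emb Γ)` is the image of the
finite-dimensional `H²(P_Γ, ℂ)`, `Universe.instFinite`), and it is what turns the closure into a finite sum: no «PerL Lemma 3.5
at a fixed level» enters.

## Contents (namespace `Summit.HodgeConjecture.CorCM`)
* `Universe.map_emb_wedgeSpan_mono` — `(wedgeSpan Γ').map (emb Γ') ≤ (wedgeSpan Γ₀).map (emb Γ₀)` for `Γ₀ ≤ Γ'` (pull back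
  along `cover`; `emb_cover`, `Fact_pull_cup`, `Fact_pull_comp`).
* `Universe.eq_of_emb_eq_of_hodgeRiemann` — `emb Γ` is injective on `F²H²(P_Γ)` (`inner_emb` + Hodge–Riemann (2,0)).
* `Universe.exists_pullC_cover_mem_wedgeSpan_of_coupling_of_descent` — THE DESCENT LEMMA: a class `x ∈ F²H²(P_Γ)` whose
  `L²`-image lies in the closed (34)-span and admits an operator `P` with (P1)(P2) becomes, pulled back to some level `Γ₀ ≤ Γ`
  along the covering, a finite sum of (34)-wedges of `U_ψ`-classes at level `Γ₀`.
* `Universe.faceWedgeOverlap_of_dictionary_coupling_descent` — **B01-O AS TYPED on any universe** with `Fact_pull_comp`,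
  `Fact_pull_hodge`, `Fact_cup2_hodge`, `Fact_pull_cup` and Hodge–Riemann (2,0) on the towers, FROM the clause `hD` (verbatim
  shape of `Item6HoldsRec.lean`:211–224, universe free) EXTENDED BY ONE CONJUNCT, level descent.  The witness is
  `cover^*(ω₀ ∪ ω₁)` itself (`Γ' = Γ₀`, `g = cover`), non-zero by Hodge–Riemann.
* `Model.faceWedgeOverlap_of_dictionary_coupling_descent` — the same on every model universe `picardCMUniverse hHD hI h₁ h₃`
  (facts and Hodge–Riemann (2,0) are the tree theorems `universeOf_fact_*`, `universeOf_hodgeRiemann_pms`): the leaf `hO` of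
  `Model.perLFace_of_PerL_of_supply_heckeWedge10_overlap` (`B01/FaceInputsSplit.lean`:236) ⇐ `hD` ∧ LEVEL DESCENT, BY NAME.

READING FOR THE B01 ROW: B01-O carries NO mathematics beyond the live target `hD` except LEVEL DESCENT (P1)(P2), a known-result
binder on the dictionary's `HG`; it is not discharged on `U_rec` here because the dictionary of record is TYPE-FREE (no
`G_U(𝔸_f)`-action on `HG`, `Item3Automorphic.lean`:93 «TYPE-FREE»).  HC_CM is NOT proved; B01-O is NOT proved; nothing here is inhabited.
-/

noncomputable section

open scoped TensorProduct InnerProductSpace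

namespace Summit.HodgeConjecture.CorCM

open Literature.AlgebraicGeometry.Motives (CMType HodgeStructure)
open Literature.AlgebraicGeometry.Motives.HodgeStructure (conj)

namespace Universe

variable {U : Universe} {L : CMField} {ι₁ : L →+* ℂ} {V : HermSpace3 L ι₁}
  {HG : Type*} [NormedAddCommGroup HG] [InnerProductSpace ℂ HG]

/-! ## §1  Two bookkeeping lemmas on a dictionary `(HG, emb, cover)` -/

/-- Pulling back along the level covering `P_{Γ₀} → P_{Γ'}` maps (34)-wedges of `U_ψ`-classes at level `Γ'` to (34)-wedges
of `U_ψ`-classes at level `Γ₀` and does not change `L²`-images (`emb_cover`); hence the embedded wedge spans INCREASE down the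
tower. [folklore] -/
theorem map_emb_wedgeSpan_mono (hc : U.Fact_pull_comp) (hpc : U.Fact_pull_cup)
    (emb : ∀ Γ : Level V, U.CohC (U.pms L ι₁ V Γ) 2 →ₗ[ℂ] HG)
    (cover : ∀ (Γ Γ' : Level V), Γ' ≤ Γ → U.Mor (U.pms L ι₁ V Γ') (U.pms L ι₁ V Γ))
    (emb_cover : ∀ (Γ Γ' : Level V) (h : Γ' ≤ Γ) (x : U.CohC (U.pms L ι₁ V Γ) 2),
      emb Γ' (U.pullC (cover Γ Γ' h) 2 x) = emb Γ x)
    (K : CMField) (Ψ Ψ' : CMType K) (σ : K →+* ℂ) {Γ' Γ₀ : Level V} (hle : Γ₀ ≤ Γ') :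
    (U.wedgeSpan Γ' K Ψ Ψ' σ).map (emb Γ') ≤ (U.wedgeSpan Γ₀ K Ψ Ψ' σ).map (emb Γ₀) := by
  rintro y ⟨w, hw, rfl⟩
  refine ⟨U.pullC (cover Γ' Γ₀ hle) 2 w, ?_, emb_cover Γ' Γ₀ hle w⟩
  unfold Universe.wedgeSpan at hw ⊢
  refine Submodule.span_induction (p := fun w _ => U.pullC (cover Γ' Γ₀ hle) 2 w ∈ _) ?_ ?_ ?_ ?_ hw
  · rintro _ ⟨ω₂, ω₃, h₂, h₃, rfl⟩
    refine Submodule.subset_span ⟨U.pullC (cover Γ' Γ₀ hle) 1 ω₂, U.pullC (cover Γ' Γ₀ hle) 1 ω₃,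
      pullC_mem_Uiso hc _ K Ψ σ h₂, pullC_mem_Uiso hc _ K Ψ' σ h₃, ?_⟩
    exact pullC_cup2C hpc _ 1 ω₂ ω₃
  · rw [map_zero]; exact Submodule.zero_mem _
  · intro a b _ _ ha hb
    rw [map_add]; exact Submodule.add_mem _ ha hb
  · intro c a _ ha
    rw [map_smul]; exact Submodule.smul_mem _ c ha

/-- A linear map `e : H²(X, ℂ) → HG` with «Petersson = cup pairing on `F²`, non-zero constant» (`inner_emb`) is injective on
`F²H²(X, ℂ)` when Hodge–Riemann (2,0) holds on `X`. [folklore] -/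
theorem eq_of_emb_eq_of_hodgeRiemann {X : U.Var} (e : U.CohC X 2 →ₗ[ℂ] HG)
    (hinner : ∃ c : ℂ, c ≠ 0 ∧ ∀ x y : U.CohC X 2, x ∈ (U.hodge X 2).F 2 → y ∈ (U.hodge X 2).F 2 →
      ⟪e y, e x⟫_ℂ = c * U.trC X 4 (U.cup2C X 2 x (conj y)))
    (hHR : ∀ η : U.CohC X 2, η ∈ (U.hodge X 2).F 2 → η ≠ 0 → U.trC X 4 (U.cup2C X 2 η (conj η)) ≠ 0)
    {x y : U.CohC X 2} (hx : x ∈ (U.hodge X 2).F 2) (hy : y ∈ (U.hodge X 2).F 2) (h : e x = e y) : x = y := by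
  obtain ⟨c, hc0, hcΛ⟩ := hinner
  have hxy : x - y ∈ (U.hodge X 2).F 2 := Submodule.sub_mem _ hx hy
  by_contra hne
  have key := hcΛ (x - y) (x - y) hxy hxy
  rw [map_sub, h, sub_self, inner_zero_left] at key
  exact (mul_ne_zero hc0 (hHR (x - y) hxy (sub_ne_zero.mpr hne))) key.symm

/-! ## §2  The descent lemma -/

/-- A finite family of levels and one more level have a common lower bound (`Level V` is an inf-semilattice). [folklore] -/
private theorem exists_level_le_finset {ι : Type*} (s : Finset ι) (lev : ι → Level V) (Γ : Level V) :
    ∃ Γ₀ : Level V, Γ₀ ≤ Γ ∧ ∀ i ∈ s, Γ₀ ≤ lev i := by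
  classical
  induction s using Finset.induction_on with
  | empty => exact ⟨Γ, le_rfl, fun i hi => absurd hi (by simp)⟩
  | insert a s _ ih =>
    obtain ⟨Γ₁, h₁, h⟩ := ih
    refine ⟨Γ₁ ⊓ lev a, inf_le_left.trans h₁, fun i hi => ?_⟩
    rcases Finset.mem_insert.mp hi with rfl | hi
    · exact inf_le_right
    · exact inf_le_left.trans (h i hi)

/-- **THE DESCENT LEMMA.**  Let `(HG, emb, cover, emb_cover, inner_emb)` be a dictionary, `x ∈ F²H²(P_Γ, ℂ)` a class whose
`L²`-image `v = emb Γ x` lies in the CLOSED span of the (34)-wedge-functions `S₃₄ = {emb Γ'' (ω₃ ∪ ω₄)}` of `U_Ψ`/`U_{Ψ'}`-classes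
over all levels, and `P : HG →L[ℂ] HG` an operator with `P v = v` sending every element of `S₃₄` to a level-`Γ` vector
(`range (emb Γ)`) that is a finite sum of embedded (34)-wedges at some level.  Then `cover^* x` IS a finite sum of (34)-wedges of
`U_Ψ`/`U_{Ψ'}`-classes at some level `Γ₀ ≤ Γ`.
Proof: `v = P v ∈ P (closure (span S₃₄)) ⊆ closure (span (P '' S₃₄))`; `span (P '' S₃₄) ≤ range (emb Γ)` is
finite-dimensional, hence closed, so `v` is a finite combination of elements of `P '' S₃₄`, each an embedded wedge sum at some
level; pull them and `x` back to a common level `Γ₀ ≤ Γ` (`map_emb_wedgeSpan_mono`); conclude by injectivity of `emb Γ₀` on `F²`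
(`eq_of_emb_eq_of_hodgeRiemann`). [folklore] -/
theorem exists_pullC_cover_mem_wedgeSpan_of_coupling_of_descent (hc : U.Fact_pull_comp) (hH : U.Fact_pull_hodge)
    (hcup2 : U.Fact_cup2_hodge) (hpc : U.Fact_pull_cup)
    (hHR : ∀ (Γ : Level V) (η : U.CohC (U.pms L ι₁ V Γ) 2),
      η ∈ (U.hodge (U.pms L ι₁ V Γ) 2).F 2 → η ≠ 0 → U.trC (U.pms L ι₁ V Γ) 4 (U.cup2C (U.pms L ι₁ V Γ) 2 η (conj η)) ≠ 0)
    (emb : ∀ Γ : Level V, U.CohC (U.pms L ι₁ V Γ) 2 →ₗ[ℂ] HG)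
    (cover : ∀ (Γ Γ' : Level V), Γ' ≤ Γ → U.Mor (U.pms L ι₁ V Γ') (U.pms L ι₁ V Γ))
    (emb_cover : ∀ (Γ Γ' : Level V) (h : Γ' ≤ Γ) (x : U.CohC (U.pms L ι₁ V Γ) 2),
      emb Γ' (U.pullC (cover Γ Γ' h) 2 x) = emb Γ x)
    (inner_emb : ∀ Γ : Level V, ∃ c : ℂ, c ≠ 0 ∧ ∀ x y : U.CohC (U.pms L ι₁ V Γ) 2,
      x ∈ (U.hodge (U.pms L ι₁ V Γ) 2).F 2 → y ∈ (U.hodge (U.pms L ι₁ V Γ) 2).F 2 →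
        ⟪emb Γ y, emb Γ x⟫_ℂ = c * U.trC (U.pms L ι₁ V Γ) 4 (U.cup2C (U.pms L ι₁ V Γ) 2 x (conj y)))
    (K : CMField) (Ψ Ψ' : CMType K) (σ : K →+* ℂ)
    {Γ : Level V} {x : U.CohC (U.pms L ι₁ V Γ) 2} (hx : x ∈ (U.hodge (U.pms L ι₁ V Γ) 2).F 2)
    (hcoup : emb Γ x ∈ (Submodule.span ℂ
      {y : HG | ∃ (Γ'' : Level V), ∃ ω₃ ∈ U.Uiso Γ'' K Ψ σ, ∃ ω₄ ∈ U.Uiso Γ'' K Ψ' σ,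
        y = emb Γ'' (U.cup2C (U.pms L ι₁ V Γ'') 1 ω₃ ω₄)}).topologicalClosure)
    (P : HG →L[ℂ] HG) (hPv : P (emb Γ x) = emb Γ x)
    (hP : ∀ y ∈ {y : HG | ∃ (Γ'' : Level V), ∃ ω₃ ∈ U.Uiso Γ'' K Ψ σ, ∃ ω₄ ∈ U.Uiso Γ'' K Ψ' σ,
        y = emb Γ'' (U.cup2C (U.pms L ι₁ V Γ'') 1 ω₃ ω₄)},
      P y ∈ LinearMap.range (emb Γ) ∧ ∃ Γ' : Level V, P y ∈ (U.wedgeSpan Γ' K Ψ Ψ' σ).map (emb Γ')) :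
    ∃ (Γ₀ : Level V) (h₀ : Γ₀ ≤ Γ), U.pullC (cover Γ Γ₀ h₀) 2 x ∈ U.wedgeSpan Γ₀ K Ψ Ψ' σ := by
  classical
  set S : Set HG := {y : HG | ∃ (Γ'' : Level V), ∃ ω₃ ∈ U.Uiso Γ'' K Ψ σ, ∃ ω₄ ∈ U.Uiso Γ'' K Ψ' σ,
    y = emb Γ'' (U.cup2C (U.pms L ι₁ V Γ'') 1 ω₃ ω₄)} with hS_def
  -- Step 1: `emb Γ x ∈ closure (span (P '' S))`
  have h1 : emb Γ x ∈ closure ((Submodule.span ℂ (P '' S) : Submodule ℂ HG) : Set HG) := by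
    have hvc : emb Γ x ∈ closure ((Submodule.span ℂ S : Submodule ℂ HG) : Set HG) := by
      rw [← Submodule.topologicalClosure_coe]; exact hcoup
    have himg : P (emb Γ x) ∈ P '' closure ((Submodule.span ℂ S : Submodule ℂ HG) : Set HG) := ⟨emb Γ x, hvc, rfl⟩
    rw [hPv] at himg
    have hsub := image_closure_subset_closure_image (s := ((Submodule.span ℂ S : Submodule ℂ HG) : Set HG))
      P.continuous
    have hspan : P '' ((Submodule.span ℂ S : Submodule ℂ HG) : Set HG) =
        ((Submodule.span ℂ (P '' S) : Submodule ℂ HG) : Set HG) := by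
      rw [← ContinuousLinearMap.coe_coe, ← Submodule.map_coe, Submodule.map_span]
    rw [hspan] at hsub
    exact hsub himg
  -- Step 2: `span (P '' S) ≤ range (emb Γ)` is finite-dimensional, hence closed
  have hle : Submodule.span ℂ (P '' S) ≤ LinearMap.range (emb Γ) := by
    refine Submodule.span_le.mpr ?_
    rintro _ ⟨y, hy, rfl⟩
    exact (hP y hy).1
  haveI : FiniteDimensional ℂ (Submodule.span ℂ (P '' S)) := Submodule.finiteDimensional_of_le hle
  have hclosed : IsClosed ((Submodule.span ℂ (P '' S) : Submodule ℂ HG) : Set HG) :=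
    Submodule.closed_of_finiteDimensional _
  rw [hclosed.closure_eq] at h1
  -- Step 3: `emb Γ x` is a finite combination of elements of `P '' S`, each an embedded wedge sum at some level
  obtain ⟨T, hTS, hvT⟩ := Submodule.mem_span_finite_of_mem_span h1
  have hlev : ∀ t ∈ T, ∃ Γ' : Level V, (t : HG) ∈ (U.wedgeSpan Γ' K Ψ Ψ' σ).map (emb Γ') := by
    intro t ht
    obtain ⟨y, hy, rfl⟩ := hTS ht
    exact (hP y hy).2
  haveI : Nonempty (Level V) := ⟨Γ⟩
  choose! lev hlev using hlev
  -- a common level `Γ₀ ≤ Γ` below all of them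
  obtain ⟨Γ₀, h₀, hΓ₀⟩ := exists_level_le_finset T lev Γ
  have hT : (T : Set HG) ⊆ (U.wedgeSpan Γ₀ K Ψ Ψ' σ).map (emb Γ₀) := fun t ht =>
    map_emb_wedgeSpan_mono hc hpc emb cover emb_cover K Ψ Ψ' σ (hΓ₀ t ht) (hlev t ht)
  obtain ⟨w, hw, hwv⟩ := (Submodule.span_le.mpr hT) hvT
  -- Step 4: `cover^* x` and `w` are two `F²`-classes at level `Γ₀` with the same `L²`-image: they are equal
  refine ⟨Γ₀, h₀, ?_⟩
  have hx₀ : U.pullC (cover Γ Γ₀ h₀) 2 x ∈ (U.hodge (U.pms L ι₁ V Γ₀) 2).F 2 :=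
    hH _ _ (cover Γ Γ₀ h₀) 2 2 (Submodule.mem_map_of_mem hx)
  have hwF : w ∈ (U.hodge (U.pms L ι₁ V Γ₀) 2).F 2 := by
    refine (Submodule.span_le.mpr ?_) hw
    rintro _ ⟨ω₂, ω₃, h₂, h₃, rfl⟩
    exact cup2C_mem_F_two_of_Uiso hH hcup2 Γ₀ K Ψ Ψ' σ h₂ h₃
  have heq : U.pullC (cover Γ Γ₀ h₀) 2 x = w :=
    eq_of_emb_eq_of_hodgeRiemann (emb Γ₀) (inner_emb Γ₀) (hHR Γ₀) hx₀ hwF (by rw [emb_cover Γ Γ₀ h₀ x, hwv])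
  rw [heq]
  exact hw

end Universe

namespace Universe

variable {U : Universe}

/-! ## §3  B01-O as typed from dictionary + saturated coupling + level descent -/

/-- **B01-O AS TYPED (`Universe.FaceWedgeOverlap`) from the clause `hD` (item (iii) dictionary with item (v)'s saturated
coupling, verbatim shape of `Transposition/Item6HoldsRec.lean`:211–224) EXTENDED BY ONE CONJUNCT, LEVEL DESCENT**, on any
universe with `Fact_pull_comp`, `Fact_pull_hodge`, `Fact_cup2_hodge`, `Fact_pull_cup` and Hodge–Riemann (2,0) on the towers.
The extra conjunct: for every level `Γ` and (12)-pair `(ω₀, ω₁)` of `U_{ψ₀}`/`U_{ψ₁}`-classes an operator `P : HG →L[ℂ] HG` with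
(P1) `P (emb Γ (ω₀ ∪ ω₁)) = emb Γ (ω₀ ∪ ω₁)` and (P2) `P` maps every (34)-wedge-function into `range (emb Γ)` and into SOME
`(wedgeSpan Γ' ψ₂ ψ₃).map (emb Γ')` (module docstring: the `K_Γ`-averaging projector).  The witness of `FaceWedgeOverlap` is the
pull-back `cover^*(ω₀ ∪ ω₁)` to the level `Γ₀` of the descent lemma: a translate (`heckeSpan`, `g = cover`), a sum of
(34)-wedges there, and non-zero by Hodge–Riemann (`emb_cover`, `eq_of_emb_eq_of_hodgeRiemann`). [folklore] -/
theorem faceWedgeOverlap_of_dictionary_coupling_descent (hc : U.Fact_pull_comp) (hH : U.Fact_pull_hodge)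
    (hcup2 : U.Fact_cup2_hodge) (hpc : U.Fact_pull_cup)
    (hHR : ∀ {L : CMField} {ι₁ : L →+* ℂ} {V : HermSpace3 L ι₁} (Γ : Level V) (η : U.CohC (U.pms L ι₁ V Γ) 2),
      η ∈ (U.hodge (U.pms L ι₁ V Γ) 2).F 2 → η ≠ 0 → U.trC (U.pms L ι₁ V Γ) 4 (U.cup2C (U.pms L ι₁ V Γ) 2 η (conj η)) ≠ 0)
    (h : ∀ (F : CMField), IsGalois ℚ F → 6 ≤ Module.finrank ℚ F → ∀ (f : Face F) (ι₁ : F →+* ℂ), f.Admissible ι₁ →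
      ∀ V : HermSpace3 F ι₁,
        ∃ (HG : Type) (_ : NormedAddCommGroup HG) (_ : InnerProductSpace ℂ HG)
          (emb : ∀ Γ : Level V, U.CohC (U.pms F ι₁ V Γ) 2 →ₗ[ℂ] HG)
          (cover : ∀ (Γ Γ' : Level V), Γ' ≤ Γ → U.Mor (U.pms F ι₁ V Γ') (U.pms F ι₁ V Γ)),
          (∀ (Γ : Level V) (ω₁ ω₂ : U.CohC (U.pms F ι₁ V Γ) 1), ω₁ ∈ U.Uiso Γ F (f.psi 0) ι₁ → ω₂ ∈ U.Uiso Γ F (f.psi 1) ι₁ →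
            emb Γ (U.cup2C (U.pms F ι₁ V Γ) 1 ω₁ ω₂) ∈ (Submodule.span ℂ
              {x : HG | ∃ (Γ' : Level V), ∃ ω₃ ∈ U.Uiso Γ' F (f.psi 2) ι₁, ∃ ω₄ ∈ U.Uiso Γ' F (f.psi 3) ι₁,
                x = emb Γ' (U.cup2C (U.pms F ι₁ V Γ') 1 ω₃ ω₄)}).topologicalClosure) ∧
          (∀ (Γ Γ' : Level V) (hle : Γ' ≤ Γ) (x : U.CohC (U.pms F ι₁ V Γ) 2),
            emb Γ' (U.pullC (cover Γ Γ' hle) 2 x) = emb Γ x) ∧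
          (∀ Γ : Level V, ∃ c : ℂ, c ≠ 0 ∧ ∀ x y : U.CohC (U.pms F ι₁ V Γ) 2,
            x ∈ (U.hodge (U.pms F ι₁ V Γ) 2).F 2 → y ∈ (U.hodge (U.pms F ι₁ V Γ) 2).F 2 →
              ⟪emb Γ y, emb Γ x⟫_ℂ = c * U.trC (U.pms F ι₁ V Γ) 4 (U.cup2C (U.pms F ι₁ V Γ) 2 x (conj y))) ∧
          (∀ (Γ : Level V) (ω₁ ω₂ : U.CohC (U.pms F ι₁ V Γ) 1), ω₁ ∈ U.Uiso Γ F (f.psi 0) ι₁ → ω₂ ∈ U.Uiso Γ F (f.psi 1) ι₁ →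
            ∃ P : HG →L[ℂ] HG, P (emb Γ (U.cup2C (U.pms F ι₁ V Γ) 1 ω₁ ω₂)) = emb Γ (U.cup2C (U.pms F ι₁ V Γ) 1 ω₁ ω₂) ∧
              ∀ y ∈ {x : HG | ∃ (Γ' : Level V), ∃ ω₃ ∈ U.Uiso Γ' F (f.psi 2) ι₁, ∃ ω₄ ∈ U.Uiso Γ' F (f.psi 3) ι₁,
                  x = emb Γ' (U.cup2C (U.pms F ι₁ V Γ') 1 ω₃ ω₄)},
                P y ∈ LinearMap.range (emb Γ) ∧
                  ∃ Γ' : Level V, P y ∈ (U.wedgeSpan Γ' F (f.psi 2) (f.psi 3) ι₁).map (emb Γ'))) :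
    U.FaceWedgeOverlap := by
  intro F hG h6 f ι₁ hι V Γ ω₀ ω₁ hω₀ hω₁ hne
  obtain ⟨HG, _, _, emb, cover, hα, hcov, hinner, hβ⟩ := h F hG h6 f ι₁ hι V
  obtain ⟨P, hPv, hP⟩ := hβ Γ ω₀ ω₁ hω₀ hω₁
  have hxF : U.cup2C (U.pms F ι₁ V Γ) 1 ω₀ ω₁ ∈ (U.hodge (U.pms F ι₁ V Γ) 2).F 2 :=
    cup2C_mem_F_two_of_Uiso hH hcup2 Γ F (f.psi 0) (f.psi 1) ι₁ hω₀ hω₁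
  obtain ⟨Γ₀, h₀, hmem⟩ := exists_pullC_cover_mem_wedgeSpan_of_coupling_of_descent hc hH hcup2 hpc
    (fun Γ η hη hη0 => hHR Γ η hη hη0) emb cover hcov hinner F (f.psi 2) (f.psi 3) ι₁ hxF (hα Γ ω₀ ω₁ hω₀ hω₁) P hPv hP
  refine ⟨Γ₀, U.pullC (cover Γ Γ₀ h₀) 2 (U.cup2C (U.pms F ι₁ V Γ) 1 ω₀ ω₁), ?_,
    Submodule.subset_span ⟨cover Γ Γ₀ h₀, rfl⟩, hmem⟩
  -- non-vanishing: the `L²`-image is that of `ω₀ ∪ ω₁`, non-zero by Hodge–Riemann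
  intro h0
  have himg : emb Γ (U.cup2C (U.pms F ι₁ V Γ) 1 ω₀ ω₁) = emb Γ 0 := by
    rw [← hcov Γ Γ₀ h₀, h0, map_zero, map_zero]
  exact hne (eq_of_emb_eq_of_hodgeRiemann (emb Γ) (hinner Γ) (fun η hη hη0 => hHR Γ η hη hη0) hxF
    (Submodule.zero_mem _) himg)

end Universe

/-! ## §4  The model universe: the leaf `hO` of B01 from `hD` and level descent, BY NAME -/

namespace Model

open Literature.NumberTheory.Automorphic
open Literature.NumberTheory.Automorphic.PicardCM
open Literature.AlgebraicGeometry.HodgeTheory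

/-- **B01-O BY NAME on every model universe from `hD` ∧ LEVEL DESCENT** (the four facts and Hodge–Riemann (2,0) on `P_Γ` are
the tree theorems `universeOf_fact_pull_comp/_pull_hodge/_cup2_hodge/_pull_cup`, `universeOf_hodgeRiemann_pms`).  The
hypothesis is the clause `hD` of `Model.hc_cm_of_supply_of_dictionary_of_eq` / `faceThetaDataExists_of_supply_of_dictionary`
(`Transposition/Item6HoldsRec.lean`:157–175, :211–224) with ONE MORE CONJUNCT (level descent); the conclusion is the leaf `hO`
of `Model.perLFace_of_PerL_of_supply_heckeWedge10_overlap` (`B01/FaceInputsSplit.lean`:236) at `(hHD, hI, h₁, h₃)`.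
B01-O is NOT proved: `h` is inhabited by no one. [folklore] -/
theorem faceWedgeOverlap_of_dictionary_coupling_descent (hHD : exists_isReal_hodgeModel)
    (hI : hodgePQ_independent_of_hodgeModel) (h₁ : BallQuotientUniformised) (h₃ : CMAbelianVarietyRealised)
    (h : ∀ (F : CMField), IsGalois ℚ F → 6 ≤ Module.finrank ℚ F → ∀ (f : Face F) (ι₁ : F →+* ℂ), f.Admissible ι₁ →
      ∀ V : HermSpace3 F ι₁,
        ∃ (HG : Type) (_ : NormedAddCommGroup HG) (_ : InnerProductSpace ℂ HG)
          (emb : ∀ Γ : Level V, (picardCMUniverse hHD hI h₁ h₃).CohC ((picardCMUniverse hHD hI h₁ h₃).pms F ι₁ V Γ) 2 →ₗ[ℂ] HG)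
          (cover : ∀ (Γ Γ' : Level V), Γ' ≤ Γ →
            (picardCMUniverse hHD hI h₁ h₃).Mor ((picardCMUniverse hHD hI h₁ h₃).pms F ι₁ V Γ')
              ((picardCMUniverse hHD hI h₁ h₃).pms F ι₁ V Γ)),
          (∀ (Γ : Level V) (ω₁ ω₂ : (picardCMUniverse hHD hI h₁ h₃).CohC ((picardCMUniverse hHD hI h₁ h₃).pms F ι₁ V Γ) 1),
            ω₁ ∈ (picardCMUniverse hHD hI h₁ h₃).Uiso Γ F (f.psi 0) ι₁ →
            ω₂ ∈ (picardCMUniverse hHD hI h₁ h₃).Uiso Γ F (f.psi 1) ι₁ →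
            emb Γ ((picardCMUniverse hHD hI h₁ h₃).cup2C ((picardCMUniverse hHD hI h₁ h₃).pms F ι₁ V Γ) 1 ω₁ ω₂) ∈
              (Submodule.span ℂ {x : HG | ∃ (Γ' : Level V), ∃ ω₃ ∈ (picardCMUniverse hHD hI h₁ h₃).Uiso Γ' F (f.psi 2) ι₁,
                ∃ ω₄ ∈ (picardCMUniverse hHD hI h₁ h₃).Uiso Γ' F (f.psi 3) ι₁,
                x = emb Γ' ((picardCMUniverse hHD hI h₁ h₃).cup2C ((picardCMUniverse hHD hI h₁ h₃).pms F ι₁ V Γ') 1 ω₃ ω₄)}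
                ).topologicalClosure) ∧
          (∀ (Γ Γ' : Level V) (hle : Γ' ≤ Γ)
            (x : (picardCMUniverse hHD hI h₁ h₃).CohC ((picardCMUniverse hHD hI h₁ h₃).pms F ι₁ V Γ) 2),
            emb Γ' ((picardCMUniverse hHD hI h₁ h₃).pullC (cover Γ Γ' hle) 2 x) = emb Γ x) ∧
          (∀ Γ : Level V, ∃ c : ℂ, c ≠ 0 ∧
            ∀ x y : (picardCMUniverse hHD hI h₁ h₃).CohC ((picardCMUniverse hHD hI h₁ h₃).pms F ι₁ V Γ) 2,
            x ∈ ((picardCMUniverse hHD hI h₁ h₃).hodge ((picardCMUniverse hHD hI h₁ h₃).pms F ι₁ V Γ) 2).F 2 →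
            y ∈ ((picardCMUniverse hHD hI h₁ h₃).hodge ((picardCMUniverse hHD hI h₁ h₃).pms F ι₁ V Γ) 2).F 2 →
              ⟪emb Γ y, emb Γ x⟫_ℂ = c * (picardCMUniverse hHD hI h₁ h₃).trC ((picardCMUniverse hHD hI h₁ h₃).pms F ι₁ V Γ) 4
                ((picardCMUniverse hHD hI h₁ h₃).cup2C ((picardCMUniverse hHD hI h₁ h₃).pms F ι₁ V Γ) 2 x (conj y))) ∧
          (∀ (Γ : Level V) (ω₁ ω₂ : (picardCMUniverse hHD hI h₁ h₃).CohC ((picardCMUniverse hHD hI h₁ h₃).pms F ι₁ V Γ) 1),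
            ω₁ ∈ (picardCMUniverse hHD hI h₁ h₃).Uiso Γ F (f.psi 0) ι₁ →
            ω₂ ∈ (picardCMUniverse hHD hI h₁ h₃).Uiso Γ F (f.psi 1) ι₁ →
            ∃ P : HG →L[ℂ] HG,
              P (emb Γ ((picardCMUniverse hHD hI h₁ h₃).cup2C ((picardCMUniverse hHD hI h₁ h₃).pms F ι₁ V Γ) 1 ω₁ ω₂)) =
                emb Γ ((picardCMUniverse hHD hI h₁ h₃).cup2C ((picardCMUniverse hHD hI h₁ h₃).pms F ι₁ V Γ) 1 ω₁ ω₂) ∧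
              ∀ y ∈ {x : HG | ∃ (Γ' : Level V), ∃ ω₃ ∈ (picardCMUniverse hHD hI h₁ h₃).Uiso Γ' F (f.psi 2) ι₁,
                  ∃ ω₄ ∈ (picardCMUniverse hHD hI h₁ h₃).Uiso Γ' F (f.psi 3) ι₁,
                  x = emb Γ' ((picardCMUniverse hHD hI h₁ h₃).cup2C
                    ((picardCMUniverse hHD hI h₁ h₃).pms F ι₁ V Γ') 1 ω₃ ω₄)},
                P y ∈ LinearMap.range (emb Γ) ∧
                  ∃ Γ'' : Level V, P y ∈ ((picardCMUniverse hHD hI h₁ h₃).wedgeSpan Γ'' F (f.psi 2) (f.psi 3) ι₁).map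
                    (emb Γ''))) :
    (picardCMUniverse hHD hI h₁ h₃).FaceWedgeOverlap :=
  Universe.faceWedgeOverlap_of_dictionary_coupling_descent
    (universeOf_fact_pull_comp hHD hI (ballQuotientUniformisedDatum_of h₁) h₃)
    (universeOf_fact_pull_hodge hHD hI (ballQuotientUniformisedDatum_of h₁) h₃)
    (universeOf_fact_cup2_hodge hHD hI (ballQuotientUniformisedDatum_of h₁) h₃)
    (universeOf_fact_pull_cup hHD hI (ballQuotientUniformisedDatum_of h₁) h₃)
    (fun Γ η hη h0 => universeOf_hodgeRiemann_pms hHD hI (ballQuotientUniformisedDatum_of h₁) h₃ _ Γ η hη h0) h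

end Model

end Summit.HodgeConjecture.CorCM

end
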